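import Summits.ValiantsHypothesis.ValiantsHypothesis.Theorems.LacunarySymmetroidMatrixDescartesCensusTropicalKLawSlopes

/-!
# Route `KPlusLogSqLaw`, crux `TropicalB` — SEPARABLE valuations carry no permutation register

HONEST FRAMING.  Helper toward the registered stubs `stub_tropThin` / `stub_tropFat` of
`Cruxes/TropicalB/Lines/birth.lean` (crux `Summit.ValiantsHypothesis.ValiantsHypothesis.Theses.KPlusLogSqLaw.TropicalB`,
ledger item `stmt-ValiantsHypothesis-19771`, route `KPlusLogSqLaw`; cell `pub-symmetroid`, seat `val-sym-trop-p3`,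
2026-08-26).  A located NO-GO for a design class (register census, D3), in the tree's dominance vocabulary; nothing here
bounds `TropicalB` for general designs, and nothing bears on `KPlusLogSqLaw`, `MatrixDescartes` or `VP ≠ VNP`.

A design is SEPARABLE if every valuation splits as a (class-dependent) row part plus column part,
`v a b l = r a l + c b l`, and has FULL SUPPORT if every entry carries every class (`ε a b l ≠ 0`).  Then swapping the
rows of two columns OF THE SAME CLASS does not change the weight of a term, so a unique optimum cannot have two columns
of the same class:

* `not_swappable_of_dominant_separable` (the entrywise form: no equal-class column pair whose swapped entries are
  present), `injective_classes_of_dominant_separable` : with full support the class map of every dominant term is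
  injective; hence
  `le_of_dominant_separable : m ≤ K` whenever a dominant term exists, and `not_isDominant_separable` : for `K < m`
  there is NO dominant term at any slope (the design has no breakpoints at all);
* `separable_kPlusLogSq` : consequently separable full-support designs satisfy the crux's inequality with `C = 2` (for
  `m ≤ K` by the fat end `tropRootLawAt_fatEnd`, for `K < m` vacuously).

Located boundary: SHIFT-THREE (`…TropicalShiftThree`) is NOT separable — its shift penalty `pen(a − b)` couples row
and column — and that coupling is the whole permutation register. [folklore]
-/

set_option linter.dupNamespace false
set_option autoImplicit false

namespace Summit.ValiantsHypothesis.ValiantsHypothesis.Theorems.KPlusLogSqLaw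

open Summit.ValiantsHypothesis.ValiantsHypothesis.Theorems.MatrixDescartes.Negative
open Summit.ValiantsHypothesis.ValiantsHypothesis.Theorems.LacunarySymmetroidMatrixDescartes
open Summit.ValiantsHypothesis.ValiantsHypothesis.Theorems.LacunarySymmetroidMatrixDescartes.TropicalCensus
open scoped BigOperators
open Finset

section Separable

variable {m K : ℕ}

/-- on a full-support design every term is present. [folklore] -/
theorem termSign_ne_zero_of_full (ε : Fin m → Fin m → Fin K → ℤ) (hε : ∀ a b l, ε a b l ≠ 0)
    (q : Equiv.Perm (Fin m) × (Fin m → Fin K)) : termSign ε q ≠ 0 := by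
  unfold termSign
  refine mul_ne_zero ?_ (prod_ne_zero_iff.mpr fun i _ => hε _ _ _)
  exact_mod_cast (Equiv.Perm.sign q.1).ne_zero

/-- **Separable valuations: no swappable equal-class pair in a dominant term.**  If `v a b l = r a l + c b l` and a
dominant term `(σ, μ)` gives two columns `i ≠ i'` the same class while the two SWAPPED entries `(σ i', i)`, `(σ i, i')`
carry that class, we get a contradiction: the swapped term is present, different, and has the same weight. [folklore] -/
theorem not_swappable_of_dominant_separable (d : Fin K → ℕ) (v ε : Fin m → Fin m → Fin K → ℤ)
    (r : Fin m → Fin K → ℤ) (c : Fin m → Fin K → ℤ) (hv : ∀ a b l, v a b l = r a l + c b l)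
    (θ : ℤ) (σ : Equiv.Perm (Fin m)) (μ : Fin m → Fin K) (hp : IsDominant d v ε θ (σ, μ))
    {i i' : Fin m} (hne : i ≠ i') (hii' : μ i = μ i')
    (h1 : ε (σ i') i (μ i) ≠ 0) (h2 : ε (σ i) i' (μ i') ≠ 0) : False := by
  -- the swapped term
  set τ : Equiv.Perm (Fin m) := Equiv.swap i i' with hτ
  have hμτ : ∀ j, μ (τ j) = μ j := by
    intro j
    rcases eq_or_ne j i with rfl | hji
    · rw [hτ, Equiv.swap_apply_left]; exact hii'.symm
    · rcases eq_or_ne j i' with rfl | hji'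
      · rw [hτ, Equiv.swap_apply_right]; exact hii'
      · rw [hτ, Equiv.swap_apply_of_ne_of_ne hji hji']
  have hqne : ((σ * τ : Equiv.Perm (Fin m)), μ) ≠ (σ, μ) := by
    intro h
    have h1 : σ * τ = σ := congrArg Prod.fst h
    have h2 : τ = 1 := by
      have := congrArg (fun π => σ⁻¹ * π) h1
      simpa [← mul_assoc] using this
    have : τ i = i := by rw [h2]; rfl
    rw [hτ, Equiv.swap_apply_left] at this
    exact hne this.symm
  -- the swapped term is present: its entries are those of `(σ, μ)` except at the columns `i`, `i'`
  have hqpres : termSign ε ((σ * τ : Equiv.Perm (Fin m)), μ) ≠ 0 := by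
    have hp0 := hp.1
    unfold termSign at hp0 ⊢
    have hprod : ∏ j, ε (σ j) j (μ j) ≠ 0 := (mul_ne_zero_iff.mp hp0).2
    rw [prod_ne_zero_iff] at hprod
    refine mul_ne_zero (by exact_mod_cast (Equiv.Perm.sign _).ne_zero) (prod_ne_zero_iff.mpr fun j _ => ?_)
    simp only [Equiv.Perm.mul_apply]
    rcases eq_or_ne j i with rfl | hji
    · rw [hτ, Equiv.swap_apply_left]; exact h1
    · rcases eq_or_ne j i' with rfl | hji'
      · rw [hτ, Equiv.swap_apply_right]; exact h2
      · rw [hτ, Equiv.swap_apply_of_ne_of_ne hji hji']; exact hprod j (mem_univ _)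
  have hlt := hp.2 _ hqne hqpres
  -- but the weights agree
  have hw : tropWeight d v θ ((σ * τ : Equiv.Perm (Fin m)), μ) = tropWeight d v θ (σ, μ) := by
    unfold tropWeight
    simp only [Equiv.Perm.mul_apply, hv, sum_add_distrib]
    have e : ∑ j, r (σ (τ j)) (μ j) = ∑ j, r (σ j) (μ j) := by
      calc ∑ j, r (σ (τ j)) (μ j) = ∑ j, r (σ (τ j)) (μ (τ j)) := sum_congr rfl fun j _ => by rw [hμτ j]
        _ = ∑ j, r (σ j) (μ j) := Equiv.sum_comp τ (fun j => r (σ j) (μ j))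
    rw [e]
  rw [hw] at hlt
  exact lt_irrefl _ hlt

/-- **Separable valuations, full support: dominant terms have injective class maps.** [folklore] -/
theorem injective_classes_of_dominant_separable (d : Fin K → ℕ) (v ε : Fin m → Fin m → Fin K → ℤ)
    (r : Fin m → Fin K → ℤ) (c : Fin m → Fin K → ℤ) (hv : ∀ a b l, v a b l = r a l + c b l)
    (hε : ∀ a b l, ε a b l ≠ 0) (θ : ℤ) (σ : Equiv.Perm (Fin m)) (μ : Fin m → Fin K)
    (hp : IsDominant d v ε θ (σ, μ)) : Function.Injective μ := by
  intro i i' hii'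
  by_contra hne
  exact not_swappable_of_dominant_separable d v ε r c hv θ σ μ hp hne hii' (hε _ _ _) (hε _ _ _)

/-- **Separable valuations: a dominant term forces `m ≤ K`.** [folklore] -/
theorem le_of_dominant_separable (d : Fin K → ℕ) (v ε : Fin m → Fin m → Fin K → ℤ)
    (r : Fin m → Fin K → ℤ) (c : Fin m → Fin K → ℤ) (hv : ∀ a b l, v a b l = r a l + c b l)
    (hε : ∀ a b l, ε a b l ≠ 0) (θ : ℤ) (q : Equiv.Perm (Fin m) × (Fin m → Fin K))
    (hp : IsDominant d v ε θ q) : m ≤ K := by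
  have h := Fintype.card_le_of_injective q.2
    (injective_classes_of_dominant_separable d v ε r c hv hε θ q.1 q.2 hp)
  simpa using h

/-- **Separable valuations with `K < m` have no dominant term at any slope** (no breakpoints whatsoever). [folklore] -/
theorem not_isDominant_separable (d : Fin K → ℕ) (v ε : Fin m → Fin m → Fin K → ℤ)
    (r : Fin m → Fin K → ℤ) (c : Fin m → Fin K → ℤ) (hv : ∀ a b l, v a b l = r a l + c b l)
    (hε : ∀ a b l, ε a b l ≠ 0) (hKm : K < m) (θ : ℤ) (q : Equiv.Perm (Fin m) × (Fin m → Fin K)) :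
    ¬ IsDominant d v ε θ q :=
  fun hp => absurd (le_of_dominant_separable d v ε r c hv hε θ q hp) (not_le.mpr hKm)

/-- **Separable full-support designs satisfy the `K + log² m` law with `C = 2`**: for `K < m` there is no dominant
term (the chain hypothesis is contradictory), for `m ≤ K` the fat end `tropRootLawAt_fatEnd` applies.  HONEST RANGE: a
degenerate class (no permutation register at all). [folklore] -/
theorem separable_kPlusLogSq (d : Fin K → ℕ) (v ε : Fin m → Fin m → Fin K → ℤ)
    (r : Fin m → Fin K → ℤ) (c : Fin m → Fin K → ℤ) (hv : ∀ a b l, v a b l = r a l + c b l)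
    (hε : ∀ a b l, ε a b l ≠ 0) (hε1 : ∀ i j l, (ε i j l).natAbs ≤ 1)
    {n : ℕ} (θ : Fin (n + 1) → ℤ) (p : Fin (n + 1) → Equiv.Perm (Fin m) × (Fin m → Fin K))
    (hθ : StrictMono θ) (hdom : ∀ k, IsDominant d v ε (θ k) (p k))
    (halt : ∀ k : Fin n, termSign ε (p k.castSucc) * termSign ε (p k.succ) < 0) :
    n ≤ 2 ^ (2 * (K + Nat.log 2 m ^ 2)) := by
  rcases Nat.lt_or_ge K m with hKm | hmK
  · exact absurd (hdom 0) (not_isDominant_separable d v ε r c hv hε hKm (θ 0) (p 0))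
  · exact (tropRootLawAt_fatEnd (m := m) (K := K) hmK d v ε n θ p hε1 hθ hdom halt).trans
      (Nat.pow_le_pow_right (by norm_num) (by nlinarith))

end Separable

end Summit.ValiantsHypothesis.ValiantsHypothesis.Theorems.KPlusLogSqLaw
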